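/-
BALABAN–IMBRIE–JAFFE 1988 (CMP 114), §5.13 p.304–306 [PDF 48–50].  p.304: «f(□_i) is the product of all the factors
… localized in □_i»; p.305: «We integrate by parts all fields appearing in this formula. Each Φ contracts through a
C_s to another Φ, to an f(□_i)_s or to ℱ.»; p.306 (5.13.3): the trains end «in either δ/δΦ or ℱ» acting on
«Π_{i∈I} f(□_i)».

A CONCRETE SMOOTH CLASS FOR THE FACTORS (clause C3 of row C2.Eq5.13.3-5.13.4).  The §5.13 theorems of the tree
(`BIJ88TruncationConnected5133.dexp_eq_sum_connected`, `BIJ88WalkForm5133.dexp_eq_sum_trains`,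
`BIJ88WalkFormIntegrated5133.expect_one_eq_expansionSum_trains`) are stated for an ABSTRACT class `𝒞` of smooth
factors on the fields, with the two standing hypotheses

  `hC : ∀ G, 𝒞 G → ContDiff ℝ 1 G ∧ (∃ K₀, ∀ φ, ‖G φ‖ ≤ K₀) ∧ ∃ K₁, ∀ φ, ‖fderiv ℝ G φ‖ ≤ K₁`   (`Nice`),
  `hD : ∀ G u, 𝒞 G → 𝒞 (fun φ => fderiv ℝ G φ u)`                                               (closure),

and the membership `hH : 𝒞 H` of the observable.  This file provides THE STANDARD INSTANCE `CbInf` = `C_b^∞` (smooth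
with every derivative bounded) and proves that the printed observable `Π_{□_i⊂X} f(□_i)` of a region
(`BIJ88PolymerRep5134Gauss.obs X`, the factors read through the extension-by-zero `ext X` of the fields of `X`) belongs
to it as soon as every factor `f(□_i)` does — so the abstract-class hypotheses of the §5.13 chain are inhabited by the
natural concrete data «f(□_i) smooth with bounded derivatives».

statement-level skeleton of published theorems with citation tags; proofs where landed; nothing here is a claim
about the Yang–Mills mass gap

PDF held: `paper:balaban1988-cmp114-bij-abelian-higgs-effective-action` (journal page = PDF page + 256).

CITATION HEADER (lean-in-tree rule).  lit-balaban cell (HOME `run/shared/lean/pub/lit-balaban/`), Phase 2, seat p13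
gen 14; row **C2.Eq5.13.3-5.13.4** of `HOME/lit-balaban-r16/ROWS-C2-part2.md` (owner r16, referee ref-5), clause C3 of
the v2.148 flip record («H any member of a smooth class (print: Π_i f(□_i))»).  Mathlib used by name:
`norm_iteratedFDeriv_mul_le` (Leibniz), `norm_iteratedFDeriv_fderiv`, `ContinuousLinearMap.norm_iteratedFDeriv_comp_left`,
`ContinuousLinearMap.iteratedFDeriv_comp_right`, `ContinuousMultilinearMap.norm_compContinuousLinearMap_le`; the
closure lemmas follow the `C_b^∞` calculus pattern of the tree's Navier–Stokes files (re-proved here, Literature may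
not import Summits).

## Main statements

* `CbInf` — the class `C_b^∞`: `ContDiff ℝ ∞ G ∧ ∀ n, ∃ K, ∀ φ, ‖iteratedFDeriv ℝ n G φ‖ ≤ K`.
* `CbInf.nice` — hypothesis `hC` (C¹, bounded, bounded derivative); `CbInf.fderiv_apply` — hypothesis `hD`;
  `CbInf.of_hasCompactSupport` — smooth compactly supported functions are members (non-vacuity).
* `CbInf.const`, `CbInf.mul`, `CbInf.prod`, `CbInf.comp_clm` — closure under products and linear substitutions.
* `extCLM` — the extension by zero `ext X` as a continuous linear map; `CbInf.obs` — **`Π_{□_i⊂X} f(□_i) ∈ C_b^∞`**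
  when every `f(□_i) ∈ C_b^∞`; `CbInf.measurable`, `CbInf.bdd` — the measurability/boundedness hypotheses of
  `BIJ88PolymerRep5134DerivGauss` for such factors.

## References

* [BalabanImbrieJaffe1988] T. Bałaban, J. Imbrie, A. Jaffe, *Effective action and cluster properties of the abelian
  Higgs model*, Comm. Math. Phys. 114 (1988) 257–315, §5.13 p.304–306.
-/
import Literature.MathematicalPhysics.QuantumFieldTheory.BalabanImbrieJaffe1984to88.BIJ88PolymerRep5134Gauss
import Mathlib.Analysis.Calculus.ContDiff.Bounds

noncomputable section

namespace Literature.MathematicalPhysics.QuantumFieldTheory.BalabanImbrieJaffe1984to88.BIJ88SmoothFactors5133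

open Finset Function Set
open scoped BigOperators ContDiff

/-! ## §1  The class `C_b^∞` -/

section Cb

variable {E : Type} [NormedAddCommGroup E] [NormedSpace ℝ E]

/-- **`C_b^∞`**: smooth real functions on the (finite-dimensional) field space with EVERY derivative bounded — the
concrete class of smooth factors `f(□_i)` (*«f(□_i) is the product of all the factors … localized in □_i»*).
[cite: BalabanImbrieJaffe1988, §5.13 p.304] -/
def CbInf (G : E → ℝ) : Prop :=
  ContDiff ℝ ∞ G ∧ ∀ n : ℕ, ∃ K : ℝ, ∀ φ, ‖iteratedFDeriv ℝ n G φ‖ ≤ K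

namespace CbInf

/-- constants are in the class. [cite: BalabanImbrieJaffe1988, §5.13 p.304] -/
theorem const (a : ℝ) : CbInf (fun _ : E => a) := by
  refine ⟨contDiff_const, fun n => ?_⟩
  rcases n with _ | n
  · exact ⟨‖a‖, fun φ => by rw [norm_iteratedFDeriv_zero]⟩
  · exact ⟨0, fun φ => by rw [iteratedFDeriv_const_of_ne (by omega)]; simp⟩

/-- **non-vacuity beyond constants**: a smooth function of compact support is in the class (each derivative is
continuous of compact support, hence bounded) — e.g. smooth cut-off factors. [cite: BalabanImbrieJaffe1988, §5.13 p.304] -/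
theorem of_hasCompactSupport {G : E → ℝ} (hG : ContDiff ℝ ∞ G) (hc : HasCompactSupport G) : CbInf G :=
  ⟨hG, fun n => (hc.iteratedFDeriv n).exists_bound_of_continuous (hG.continuous_iteratedFDeriv (mod_cast le_top))⟩

/-- **hypothesis `hC` of the §5.13 chain**: a member is C¹, bounded, with bounded derivative.
[cite: BalabanImbrieJaffe1988, §5.13 p.305] -/
theorem nice {G : E → ℝ} (hG : CbInf G) :
    ContDiff ℝ 1 G ∧ (∃ K₀ : ℝ, ∀ φ, ‖G φ‖ ≤ K₀) ∧ ∃ K₁ : ℝ, ∀ φ, ‖fderiv ℝ G φ‖ ≤ K₁ := by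
  obtain ⟨K₀, h0⟩ := hG.2 0
  obtain ⟨K₁, h1⟩ := hG.2 1
  refine ⟨hG.1.of_le (mod_cast le_top), ⟨K₀, fun φ => ?_⟩, ⟨K₁, fun φ => ?_⟩⟩
  · have := h0 φ
    rwa [norm_iteratedFDeriv_zero] at this
  · have := h1 φ
    rwa [← norm_iteratedFDeriv_fderiv, norm_iteratedFDeriv_zero] at this

/-- a uniform bound on all derivatives of order `≤ n`. [cite: BalabanImbrieJaffe1988, §5.13 p.305] -/
theorem bound_le {G : E → ℝ} (hG : CbInf G) (n : ℕ) :
    ∃ K : ℝ, 0 ≤ K ∧ ∀ i ≤ n, ∀ φ, ‖iteratedFDeriv ℝ i G φ‖ ≤ K := by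
  choose K hK using hG.2
  refine ⟨∑ i ∈ range (n + 1), |K i|, sum_nonneg fun _ _ => abs_nonneg _, fun i hi φ => ?_⟩
  exact ((hK i φ).trans (le_abs_self _)).trans
    (single_le_sum (f := fun i => |K i|) (fun _ _ => abs_nonneg _) (mem_range.2 (Nat.lt_succ_of_le hi)))

/-- **products stay in the class** (Leibniz). [cite: BalabanImbrieJaffe1988, §5.13 p.304] -/
theorem mul {G G' : E → ℝ} (hG : CbInf G) (hG' : CbInf G') : CbInf (fun φ => G φ * G' φ) := by
  refine ⟨hG.1.mul hG'.1, fun n => ?_⟩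
  obtain ⟨K, hK0, hK⟩ := hG.bound_le n
  obtain ⟨K', hK0', hK'⟩ := hG'.bound_le n
  refine ⟨2 ^ n * K * K', fun φ => ?_⟩
  refine (norm_iteratedFDeriv_mul_le hG.1 hG'.1 φ (n := n) (mod_cast le_top)).trans ?_
  have hsum : ∑ i ∈ range (n + 1), (n.choose i : ℝ) * ‖iteratedFDeriv ℝ i G φ‖ * ‖iteratedFDeriv ℝ (n - i) G' φ‖
      ≤ ∑ i ∈ range (n + 1), (n.choose i : ℝ) * (K * K') := by
    refine sum_le_sum fun i hi => ?_
    have hin : i ≤ n := Nat.lt_succ_iff.1 (mem_range.1 hi)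
    rw [mul_assoc]
    exact mul_le_mul_of_nonneg_left
      (mul_le_mul (hK i hin φ) (hK' (n - i) (Nat.sub_le n i) φ) (norm_nonneg _) hK0) (by positivity)
  refine hsum.trans (le_of_eq ?_)
  rw [← sum_mul]
  have h2 : ∑ i ∈ range (n + 1), (n.choose i : ℝ) = 2 ^ n := by exact_mod_cast Nat.sum_range_choose n
  rw [h2, mul_assoc]

/-- finite products stay in the class. [cite: BalabanImbrieJaffe1988, §5.13 p.304] -/
theorem prod {ι : Type} [DecidableEq ι] (T : Finset ι) {F : ι → E → ℝ} (hF : ∀ i ∈ T, CbInf (F i)) :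
    CbInf (fun φ => ∏ i ∈ T, F i φ) := by
  induction T using Finset.induction_on with
  | empty => simpa using const (E := E) 1
  | @insert j T hj ih =>
    have h := (hF j (mem_insert_self j T)).mul (ih fun i hi => hF i (mem_insert_of_mem hi))
    refine (congrArg CbInf (funext fun φ => ?_)).mpr h
    exact prod_insert hj

/-- post-composition with a continuous linear map. [cite: BalabanImbrieJaffe1988, §5.13 p.305] -/
theorem clm_comp {W : Type} [NormedAddCommGroup W] [NormedSpace ℝ W] {F : E → W} (hF : ContDiff ℝ ∞ F)
    (hFb : ∀ n : ℕ, ∃ K : ℝ, ∀ φ, ‖iteratedFDeriv ℝ n F φ‖ ≤ K) (L : W →L[ℝ] ℝ) : CbInf (fun φ => L (F φ)) := by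
  refine ⟨L.contDiff.comp hF, fun n => ?_⟩
  obtain ⟨K, hK⟩ := hFb n
  refine ⟨‖L‖ * K, fun φ => ?_⟩
  rw [show (fun φ => L (F φ)) = L ∘ F from rfl]
  exact (L.norm_iteratedFDeriv_comp_left hF.contDiffAt (n := n) (mod_cast le_top)).trans
    (mul_le_mul_of_nonneg_left (hK φ) (norm_nonneg _))

/-- **hypothesis `hD` of the §5.13 chain**: directional derivatives of a member are members
(`‖Dⁿ(∂_u G)‖ ≤ ‖u‖ ‖Dⁿ⁺¹G‖`). [cite: BalabanImbrieJaffe1988, §5.13 p.305] -/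
theorem fderiv_apply {G : E → ℝ} (hG : CbInf G) (u : E) : CbInf (fun φ => fderiv ℝ G φ u) := by
  have h1 : ContDiff ℝ ∞ (fderiv ℝ G) := hG.1.fderiv_right (mod_cast le_top)
  have h2 : ∀ n : ℕ, ∃ K : ℝ, ∀ φ, ‖iteratedFDeriv ℝ n (fderiv ℝ G) φ‖ ≤ K := fun n => by
    obtain ⟨K, hK⟩ := hG.2 (n + 1)
    exact ⟨K, fun φ => by rw [norm_iteratedFDeriv_fderiv]; exact hK φ⟩
  exact clm_comp h1 h2 (ContinuousLinearMap.apply ℝ ℝ u)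

/-- pre-composition with a continuous linear map (a linear substitution of the fields).
[cite: BalabanImbrieJaffe1988, §5.13 p.305] -/
theorem comp_clm {E' : Type} [NormedAddCommGroup E'] [NormedSpace ℝ E'] {G : E → ℝ} (hG : CbInf G)
    (A : E' →L[ℝ] E) : CbInf (fun ψ => G (A ψ)) := by
  refine ⟨hG.1.comp A.contDiff, fun n => ?_⟩
  obtain ⟨K, hK0, hK⟩ := hG.bound_le n
  refine ⟨K * ‖A‖ ^ n, fun ψ => ?_⟩
  rw [show (fun ψ => G (A ψ)) = G ∘ A from rfl, A.iteratedFDeriv_comp_right hG.1 ψ (mod_cast le_top)]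
  refine (ContinuousMultilinearMap.norm_compContinuousLinearMap_le _ _).trans ?_
  rw [prod_const, card_univ, Fintype.card_fin]
  exact mul_le_mul_of_nonneg_right (hK n le_rfl (A ψ)) (by positivity)

/-- members are measurable. [cite: BalabanImbrieJaffe1988, §5.13 p.305] -/
theorem measurable [MeasurableSpace E] [BorelSpace E] {G : E → ℝ} (hG : CbInf G) : Measurable G :=
  hG.1.continuous.measurable

/-- members are bounded (`|G| ≤ K`). [cite: BalabanImbrieJaffe1988, §5.13 p.305] -/
theorem bdd {G : E → ℝ} (hG : CbInf G) : ∃ K : ℝ, ∀ φ, |G φ| ≤ K := by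
  obtain ⟨K, hK⟩ := hG.2 0
  exact ⟨K, fun φ => by have := hK φ; rwa [norm_iteratedFDeriv_zero, Real.norm_eq_abs] at this⟩

end CbInf

end Cb

/-! ## §2  The observable `Π_{□_i⊂X} f(□_i)` of a region is in the class -/

section Obs

variable {α I : Type} [Fintype α] [DecidableEq α] [Fintype I] [DecidableEq I]
  (blk : α → I) (f : I → (α → ℝ) → ℝ)

/-- the extension by zero `ext X` of a field on the sites of `X`, as a continuous linear map.
[cite: BalabanImbrieJaffe1988, §5.13 p.306] -/
def extCLM (X : Finset I) : (BIJ88PolymerRep5134Gauss.Site blk X → ℝ) →L[ℝ] (α → ℝ) :=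
  ContinuousLinearMap.pi fun x =>
    if h : blk x ∈ X then ContinuousLinearMap.proj (R := ℝ) (⟨x, h⟩ : BIJ88PolymerRep5134Gauss.Site blk X) else 0

omit [Fintype α] [DecidableEq α] [Fintype I] in
/-- `extCLM X φ = ext X φ`. [cite: BalabanImbrieJaffe1988, §5.13 p.306] -/
theorem extCLM_apply (X : Finset I) (φ : BIJ88PolymerRep5134Gauss.Site blk X → ℝ) :
    extCLM blk X φ = BIJ88PolymerRep5134Gauss.ext blk X φ := by
  funext x
  simp only [extCLM, ContinuousLinearMap.pi_apply, BIJ88PolymerRep5134Gauss.ext]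
  split_ifs with h
  · rfl
  · rfl

omit [DecidableEq α] [Fintype I] in
/-- **the printed observable is a smooth factor**: if every `f(□_i)`, `□_i ⊂ X`, is in `C_b^∞` (as a function of all
the fields), then `Π_{□_i⊂X} f(□_i)`, read on the fields of `X` (`obs X`), is in `C_b^∞` — the membership hypothesis
`hH` of the §5.13 chain for the print's `H = Π_i f(□_i)`. [cite: BalabanImbrieJaffe1988, §5.13 Eq. (5.13.3) p.306] -/
theorem CbInf.obs (X : Finset I) (hf : ∀ i ∈ X, CbInf (f i)) : CbInf (BIJ88PolymerRep5134Gauss.obs blk f X) := by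
  have h : CbInf (fun φ : BIJ88PolymerRep5134Gauss.Site blk X → ℝ => ∏ i ∈ X, f i (extCLM blk X φ)) :=
    CbInf.prod X fun i hi => (hf i hi).comp_clm (extCLM blk X)
  refine (congrArg CbInf (funext fun φ => ?_)).mp h
  simp only [BIJ88PolymerRep5134Gauss.obs, extCLM_apply]

end Obs

end Literature.MathematicalPhysics.QuantumFieldTheory.BalabanImbrieJaffe1984to88.BIJ88SmoothFactors5133

end
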